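import Summits.Schanuel.Schanuel.Theorems.RootDecomp1KCollarCell02

/-!
# RootDecomp1KCollarCell — lens 1, generation 48, node 7 «THE COLLAR CELL: skeleton-RESONANT dyadic approximants are never level points (2-adic interlacing, all P, m-free), with a certified member of EXACT Skel-order m» (CLAIM L2417, EX-ANTE PRICE + CHECKLIST K-g48 L2418, NODE L2431 / REQUEST L2432; critic VERDICT L2435: CLEARED AS PRICED — ONE CELL ×1 «DYADIC COLLAR», RULE K-R37, PORT GO) — continuation (RootDecomp1KCollarCell03): §3a the member ρ♮_m: run pattern, increments, the sum and its tails

(lens-1 g48 HOME kernel K = HOME/decomp-schanuel-lens-1/g48/CollarCell.lean f82e9183…, 1281 l, imports …RootDecomp1KDegreeLadder05 + …RootDecomp1KDarkLogSq04 BY NAME; P CollarCellProbe.lean 50792f78… rc 0 / C CollarCellCtrl.lean 9aabc182… rc 1 = 14 planted; memo NODE-g48.md; NODE L2431 / REQUEST L2432. Port by census-1 gen 21 as `RootDecomp1KCollarCell01–06` along K's §1–§5 with §3 cut in two by the 400-line file cap: 01 = §1 (T1) the 2-adic interlacing lemma `twoAdic_bev_ne_zero` with `maxval₂`, `weights_injective`;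 02 = §2 the class `DyadicCollarLiouville` («[class] definition» tag) and its engine `bev_ne_zero_of_collar` (T2), `algebraicIndependent_ell2_of_collar` (T3), `statement_b_on_collar_ge_one`, `not_dyadicCollarLiouville_uStar`, `sb_collarPair` / `coordLiouvilleSchanuel_collarPair` (T4, item 31077's binders verbatim at n = 2, whole class, hyp-free); 03 = §3a the run pattern `Nn`/`fN`/`gN`, increments `aN`, `rhoNat`, tails `tailN`; 04 = §3b numerators `MN`, truncations `tN`, overshoots `uN`/`UN`, `iota_two_pow_fN`, `rhoNat_ne_tN`; 05 = §4 certificates M1 `dyadicCollarLiouville_rhoNat`, M2 `skelLiouvilleFix_rhoNat`, cover `rhoNat_cover`, M3 `not_skelLiouvilleFix_succ_rhoNat` / `not_skelLiouville_rhoNat`, M4 `not_factorialGapLiouville_rhoNat`, M5 `not_logLogLiouville_rhoNat` + `not_logSqLiouville_rhoNat` / `not_logHyperLiouville_rhoNat` / `not_hyperLiouville_rhoNat` / `not_liouvilleOrder_rhoNat`, `liouville_rhoNat`, `dyadicCollarLiouville_not_subset`; 06 = §5 the exhibited tuple `zN2 = (ℓ₂, ρ♮₂)`: `linearIndependent_zN2`,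 `coordLiouvilleSpan_zN2`, `zN2_in_scope_31077`, `sb_zN2`, `coordLiouvilleSchanuel_at_zN2`, `item31077_at_zN2`, `rhoNat_two_profile` — ALL HYP-FREE. PORT EDITS (census convention, as sanctioned for every K-line port): `set_option linter.dupNamespace false` dropped; «[class] definition (membership predicate with parameters, NOT a fact; census convention)» wording on `DyadicCollarLiouville`; 35 one-line helper docstrings added; K's `liouvilleNumber_two_lt` (§2) DELETED in favour of the byte-identical tree decl `RootDecomp1KRelLiouvilleCell.liouvilleNumber_two_lt` (RelLiouvilleCell03, already in the import cone; dedup bounce p838600) — referenced via the §2 `open … (… liouvilleNumber_two_lt)` list; two generic §1 one-liners privatised; per-part private helper copies if any; statements and proofs otherwise verbatim (no renames). `--supports stmt-Schanuel-31077`; no census credit carried; rung 0 — nothing here proves Schanuel; no ∀-item moves; 31077 and 33364 stay OPEN.)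
-/

noncomputable section

open Polynomial LiouvilleNumber
open scoped Nat

namespace Summit.Schanuel.Schanuel.Theorems.RootDecomp1KCollarCell

open Summit.Schanuel.Schanuel.Theorems.RootDecomp1KDegreeLadder
  (bev bev_eq_double_sum xdeg natDegree_coeff_le_xdeg specX aeval_specX natDegree_specX_le
   abs_aeval_ge_of_ne_zero lipschitz_x lipschitz_y algebraicIndependent_of_no_relation)
open Summit.Schanuel.Schanuel.Theorems.RootDecomp1KSkelCell
  (iota iota_spec iota_le_of_le pow_lt_of_lt_iota lt_iota_of_pow_lt iota_mono one_le_iota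
   SkelLiouville SkelLiouvilleFix skelLiouville_iff_fix SkelLiouvilleFix.mono logLogLiouville_skelLiouville)
open Summit.Schanuel.Schanuel.Theorems.RootDecomp1KLogLogCell
  (LogLogLiouville logLogLiouville_of_logSqLiouville logLogLiouville_of_logHyperLiouville
   logLogLiouville_of_hyperLiouville)
open Summit.Schanuel.Schanuel.Theorems.RootDecomp1KGeneric (LogSqLiouville LiouvilleOrder)
open Summit.Schanuel.Schanuel.Theorems.RootDecomp1KRelLiouvilleCell (LogHyperLiouville)
open Summit.Schanuel.Schanuel.Theorems.RootDecomp1KDarkLogSq (logHyperLiouville_of_liouvilleOrder)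
open Summit.Schanuel.Schanuel.Theorems.RootDecomp1KTwoBaseCell
  (psNumer partialSum_eq_psNumer_div coprime_psNumer sb_of_range_eq')
open Summit.Schanuel.Schanuel.Theorems.RootDecomp1KGapCell (FactorialGapLiouville)
open Summit.Schanuel.Schanuel.Theorems.RootDecomp1KHyper
open Summit.Schanuel.Schanuel.Theorems.RootDecomp1KHyper.HyperCell

/-! ## §3  THE MEMBER `ρ♮_m`: alternating runs, truncations `t_k`, overshoots `u_k`, tails -/

/-- `N_k := m + 4 + 2k`. -/
def Nn (m k : ℕ) : ℕ := m + 4 + 2 * k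

/-- `f_k := N_k! + N_k` — position of the last `1` of the `k`-th block; `den t_k = 2^{f_k}` sits in the COLLAR of
the skeleton point `2^{N_k!}` (`h = N_k`). -/
def fN (m k : ℕ) : ℕ := (Nn m k)! + Nn m k

/-- `g_k := m (N_k + 1) f_k + 1` — position of the first `1` of the `k`-th run of ones; `den u_k = 2^{g_k − 1}`. -/
def gN (m k : ℕ) : ℕ := m * (Nn m k + 1) * fN m k + 1

/-- `N_{k+1} = N_k + 2`. -/
theorem Nn_succ (m k : ℕ) : Nn m (k + 1) = Nn m k + 2 := by unfold Nn; ring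

/-- `m + 4 ≤ N_k`. -/
theorem le_Nn (m k : ℕ) : m + 4 ≤ Nn m k := by unfold Nn; omega

/-- `2k ≤ N_k`. -/
theorem two_mul_le_Nn (m k : ℕ) : 2 * k ≤ Nn m k := by unfold Nn; omega

/-- `N_k ≤ f_k`. -/
theorem Nn_le_fN (m k : ℕ) : Nn m k ≤ fN m k := Nat.le_add_left _ _

/-- `N_k! < f_k`. -/
theorem factorial_lt_fN (m k : ℕ) : (Nn m k)! < fN m k := by
  unfold fN; have := le_Nn m k; omega

/-- `f_k ≤ (N_k + 1)!`. -/
theorem fN_le_factorial_succ (m k : ℕ) : fN m k ≤ (Nn m k + 1)! := by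
  unfold fN
  rw [Nat.factorial_succ]
  have h1 := Nat.self_le_factorial (Nn m k)
  have h2 : 1 ≤ Nn m k := by have := le_Nn m k; omega
  nlinarith

/-- `f_k < f_{k+1}`. -/
theorem fN_lt_fN_succ (m k : ℕ) : fN m k < fN m (k + 1) := by
  unfold fN
  rw [Nn_succ]
  have := Nat.factorial_le (Nat.le_add_right (Nn m k) 2)
  omega

/-- `2 f_k + 3 ≤ g_k` (`m ≥ 1`): the runs are long. -/
theorem two_fN_add_three_le_gN {m : ℕ} (hm : 1 ≤ m) (k : ℕ) : 2 * fN m k + 3 ≤ gN m k := by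
  unfold gN
  have hN : 5 ≤ Nn m k + 1 := by have := le_Nn m k; omega
  have hf : 3 ≤ fN m k := by have := Nn_le_fN m k; have := le_Nn m k; omega
  have h5 : 5 ≤ m * (Nn m k + 1) := le_trans (by norm_num) (Nat.mul_le_mul hm hN)
  nlinarith

/-- `g_k + 2 ≤ f_{k+1}`: the run of ones `[g_k, f_{k+1}]` is non-empty (indeed long). -/
theorem gN_add_two_le_fN_succ (m k : ℕ) : gN m k + 2 ≤ fN m (k + 1) := by
  have eN : Nn m k = (m + 3 + 2 * k) + 1 := by unfold Nn; ring
  have eN1 : Nn m (k + 1) = (m + 3 + 2 * k) + 3 := by unfold Nn; ring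
  unfold gN fN
  rw [eN, eN1]
  set M := m + 3 + 2 * k with hM
  have hX : m + 3 ≤ M ! := le_trans (by omega) (Nat.self_le_factorial M)
  rw [show M + 3 = (M + 2) + 1 by ring, Nat.factorial_succ (M + 2), Nat.factorial_succ (M + 1),
    Nat.factorial_succ M]
  set X := M ! with hXdef
  have h1 : (M + 2) * (M + 1) * (m + 3) ≤ (M + 2) * (M + 1) * X := Nat.mul_le_mul_left _ hX
  have h2 : (m + 6) * ((M + 2) * (M + 1) * X) ≤ (M + 2 + 1) * ((M + 2) * (M + 1) * X) :=
    Nat.mul_le_mul_right _ (by omega)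
  have h3 : m * ((M + 2) * (M + 1)) ≤ 6 * (m + 3) * ((M + 2) * (M + 1)) :=
    Nat.mul_le_mul_right _ (by omega)
  linarith

/-- `f_k + 3 ≤ g_k` (for `m ≥ 1`). -/
theorem fN_add_three_le_gN {m : ℕ} (hm : 1 ≤ m) (k : ℕ) : fN m k + 3 ≤ gN m k := by
  have := two_fN_add_three_le_gN hm k; omega

/-- `g_k < g_{k+1}` (for `m ≥ 1`). -/
theorem gN_lt_gN_succ {m : ℕ} (hm : 1 ≤ m) (k : ℕ) : gN m k < gN m (k + 1) := by
  have h1 := gN_add_two_le_fN_succ m k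
  have h2 := fN_add_three_le_gN hm (k + 1)
  omega

/-- `g_k + j ≤ g_{j+k}` (for `m ≥ 1`). -/
theorem gN_add_le_gN_add {m : ℕ} (hm : 1 ≤ m) (k j : ℕ) : gN m k + j ≤ gN m (j + k) := by
  induction j with
  | zero => simp
  | succ j ih =>
    have := gN_lt_gN_succ hm (j + k)
    rw [show j + 1 + k = j + k + 1 by ring]
    omega

/-- `k ≤ g_k` (for `m ≥ 1`). -/
theorem le_gN {m : ℕ} (hm : 1 ≤ m) (k : ℕ) : k ≤ gN m k := by
  have h1 := two_mul_le_Nn m k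
  have h2 := Nn_le_fN m k
  have h3 := fN_add_three_le_gN hm k
  omega

/-- the `k`-th run of ones `a_k := 2/2^{g_k} − 1/2^{f_{k+1}} = Σ_{g_k ≤ i ≤ f_{k+1}} 2^{−i}`. -/
def aN (m k : ℕ) : ℝ := 2 / (2 : ℝ) ^ gN m k - 1 / (2 : ℝ) ^ fN m (k + 1)

/-- `a_k < 2 / 2^{g_k}`. -/
theorem aN_lt (m k : ℕ) : aN m k < 2 / (2 : ℝ) ^ gN m k := by
  unfold aN; have : (0 : ℝ) < 1 / (2 : ℝ) ^ fN m (k + 1) := by positivity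
  linarith

/-- `1 / 2^{f_{k+1}} ≤ 1 / (4 · 2^{g_k})`. -/
theorem one_div_pow_fN_succ_le (m k : ℕ) :
    1 / (2 : ℝ) ^ fN m (k + 1) ≤ 1 / (4 * (2 : ℝ) ^ gN m k) := by
  apply one_div_le_one_div_of_le (by positivity)
  rw [show (4 : ℝ) * (2 : ℝ) ^ gN m k = (2 : ℝ) ^ (gN m k + 2) by rw [pow_add]; ring]
  exact pow_le_pow_right₀ (by norm_num) (gN_add_two_le_fN_succ m k)

/-- `a_k > 1/2^{g_k}`. -/
theorem aN_gt (m k : ℕ) : 1 / (2 : ℝ) ^ gN m k < aN m k := by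
  unfold aN
  have h := one_div_pow_fN_succ_le m k
  have hpos : (0 : ℝ) < (2 : ℝ) ^ gN m k := by positivity
  have e1 : 2 / (2 : ℝ) ^ gN m k = 2 * (1 / (2 : ℝ) ^ gN m k) := by ring
  have e2 : 1 / (4 * (2 : ℝ) ^ gN m k) = (1 / 4) * (1 / (2 : ℝ) ^ gN m k) := by
    rw [one_div_mul_one_div]
  rw [e2] at h
  have hp : (0 : ℝ) < 1 / (2 : ℝ) ^ gN m k := by positivity
  linarith

/-- `0 < a_k`. -/
theorem aN_pos (m k : ℕ) : 0 < aN m k := lt_trans (by positivity) (aN_gt m k)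

/-- `2/2^{g_{j+k}} ≤ (2/2^{g_k}) (1/2)^j`. -/
theorem two_div_pow_gN_le {m : ℕ} (hm : 1 ≤ m) (k j : ℕ) :
    2 / (2 : ℝ) ^ gN m (j + k) ≤ 2 / (2 : ℝ) ^ gN m k * (1 / 2) ^ j := by
  rw [one_div_pow, mul_one_div, div_div, ← pow_add]
  apply div_le_div_of_nonneg_left (by norm_num) (by positivity)
  exact pow_le_pow_right₀ (by norm_num) (gN_add_le_gN_add hm k j)

/-- The geometric majorant `2 / 2^{g_k} · (1/2)^j` is summable in `j`. -/
theorem summable_majorant {m : ℕ} (k : ℕ) : Summable fun j : ℕ => 2 / (2 : ℝ) ^ gN m k * (1 / 2 : ℝ) ^ j :=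
  (summable_geometric_two).mul_left _

/-- `j ↦ 2 / 2^{g_{j+k}}` is summable (for `m ≥ 1`). -/
theorem summable_two_div_pow_gN {m : ℕ} (hm : 1 ≤ m) (k : ℕ) :
    Summable fun j : ℕ => 2 / (2 : ℝ) ^ gN m (j + k) := by
  refine Summable.of_nonneg_of_le (fun _ => by positivity) (fun j => two_div_pow_gN_le hm k j) ?_
  exact summable_majorant k

/-- The shifted sequence `j ↦ a_{j+k}` is summable (for `m ≥ 1`). -/
theorem summable_aN_shift {m : ℕ} (hm : 1 ≤ m) (k : ℕ) : Summable fun j : ℕ => aN m (j + k) :=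
  Summable.of_nonneg_of_le (fun _ => (aN_pos m _).le) (fun _ => (aN_lt m _).le) (summable_two_div_pow_gN hm k)

/-- `(a_k)` is summable (for `m ≥ 1`). -/
theorem summable_aN {m : ℕ} (hm : 1 ≤ m) : Summable (aN m) := by
  have := summable_aN_shift hm 0
  simpa using this

/-- **THE MEMBER** `ρ♮_m := 2^{−f_0} + Σ_k (2^{1−g_k} − 2^{−f_{k+1}})`: binary expansion with a `1` at `f_0`,
ZEROS on `(f_k, g_k)` and ONES on `[g_k, f_{k+1}]` for every `k`. -/
def rhoNat (m : ℕ) : ℝ := 1 / (2 : ℝ) ^ fN m 0 + ∑' k, aN m k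

/-- the TAIL `T_k := Σ_{j ≥ k} a_j`. -/
def tailN (m k : ℕ) : ℝ := ∑' j, aN m (j + k)

/-- Tail recursion: `tail_k = a_k + tail_{k+1}`. -/
theorem tailN_succ {m : ℕ} (hm : 1 ≤ m) (k : ℕ) : tailN m k = aN m k + tailN m (k + 1) := by
  unfold tailN
  rw [(summable_aN_shift hm k).tsum_eq_zero_add]
  congr 1
  · simp
  · refine tsum_congr fun j => ?_
    rw [show j + 1 + k = j + (k + 1) by ring]

/-- `0 ≤ tail_k`. -/
theorem tailN_nonneg (m k : ℕ) : 0 ≤ tailN m k := tsum_nonneg fun _ => (aN_pos m _).le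

/-- `T_k < 4/2^{g_k}`. -/
theorem tailN_lt_four_div {m : ℕ} (hm : 1 ≤ m) (k : ℕ) : tailN m k < 4 / (2 : ℝ) ^ gN m k := by
  unfold tailN
  have h1 : ∑' j, aN m (j + k) < ∑' j : ℕ, 2 / (2 : ℝ) ^ gN m (j + k) :=
    Summable.tsum_lt_tsum (i := 0) (fun j => (aN_lt m _).le) (aN_lt m _) (summable_aN_shift hm k)
      (summable_two_div_pow_gN hm k)
  have h2 : ∑' j : ℕ, 2 / (2 : ℝ) ^ gN m (j + k) ≤ ∑' j : ℕ, 2 / (2 : ℝ) ^ gN m k * (1 / 2) ^ j :=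
    (summable_two_div_pow_gN hm k).tsum_le_tsum (fun j => two_div_pow_gN_le hm k j) (summable_majorant k)
  have h3 : ∑' j : ℕ, 2 / (2 : ℝ) ^ gN m k * (1 / 2) ^ j = 4 / (2 : ℝ) ^ gN m k := by
    rw [tsum_mul_left, tsum_geometric_two]; ring
  linarith

/-- `T_k < 1/2^{f_k + 1}`. -/
theorem tailN_lt_half_pow_fN {m : ℕ} (hm : 1 ≤ m) (k : ℕ) : tailN m k < 1 / (2 * (2 : ℝ) ^ fN m k) := by
  refine (tailN_lt_four_div hm k).trans_le ?_
  rw [div_le_div_iff₀ (by positivity) (by positivity)]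
  have h : (2 : ℝ) ^ (fN m k + 3) ≤ (2 : ℝ) ^ gN m k := pow_le_pow_right₀ (by norm_num) (fN_add_three_le_gN hm k)
  rw [pow_add] at h
  nlinarith

/-- `T_k < 1/2^{f_k}`. -/
theorem tailN_lt_pow_fN {m : ℕ} (hm : 1 ≤ m) (k : ℕ) : tailN m k < 1 / (2 : ℝ) ^ fN m k := by
  refine (tailN_lt_half_pow_fN hm k).trans_le ?_
  have hpos : (0 : ℝ) < (2 : ℝ) ^ fN m k := by positivity
  exact one_div_le_one_div_of_le hpos (by linarith)

/-- `T_k < 2/2^{g_k}` (`= den(t_k)^{−m ι(den t_k)}`). -/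
theorem tailN_lt_two_div {m : ℕ} (hm : 1 ≤ m) (k : ℕ) : tailN m k < 2 / (2 : ℝ) ^ gN m k := by
  rw [tailN_succ hm k]
  have h := tailN_lt_pow_fN hm (k + 1)
  unfold aN
  linarith

/-- `T_k > 1/2^{g_k}`. -/
theorem tailN_gt {m : ℕ} (hm : 1 ≤ m) (k : ℕ) : 1 / (2 : ℝ) ^ gN m k < tailN m k := by
  rw [tailN_succ hm k]
  have h1 := aN_gt m k
  have h2 := tailN_nonneg m (k + 1)
  linarith

/-- `0 < tail_k` (for `m ≥ 1`). -/
theorem tailN_pos {m : ℕ} (hm : 1 ≤ m) (k : ℕ) : 0 < tailN m k := lt_trans (by positivity) (tailN_gt hm k)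

end Summit.Schanuel.Schanuel.Theorems.RootDecomp1KCollarCell

end
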